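import Summits.HodgeConjecture.HodgeConjecture.Theorems.F0P3cStCharTSUpTrWeightIdSplitH      -- ★ (B1′) (LH7-p02∕F0P3a-p03): brings ★ `coe_eq_diag_of_mem_torusU`, `map_entry_mul_entry_eq_one_of_mem_torusU`, `cmLocalForm_eq_over`, `conjLocal_apply_eq_galAdicCompletionMap`
import Literature.NumberTheory.Rogawski1990.LocalNormFibreNonsplit                           -- ★ (F2) `isLocalStablyConjH_of_isLocalNormPair_of_finGammaTwo_eq`, `IsLocalNormPair.charpoly_eq`∕`.isRoot_finGammaTwo`, `IsLocalGRegular.separable_finCharpolyTwo`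
import Literature.NumberTheory.Rogawski1990.ExplicitFactorKappaAlmostEverywhereOne             -- ★ `conjLocal_finGammaTwo_mul_finGammaTwo` (`σ(u)·u = 1` for the `U(Φ₁)`-slot)
import Literature.NumberTheory.Automorphic.UnitaryGroupNonsplitPlace                          -- ★ `PlacesOver.subsingleton_of_smul_eq` (one place above a non-split `v`)
import Summits.HodgeConjecture.HodgeConjecture.Theorems.F0P3cStCharTSEllInnerSlotMaps         -- ★ (E2b)-C: `isUnit_sub_of_separable`
import HarnessLib

/-!
# F0 · P3c · ROAD «UP-TR» (A1″) «UP-TR-FULL», FILE U2b «SPLIT FIBRE ONE»: over the split Cartan subgroup `M_H = M₂ × U(Φ₁)(L⁺_v)` of `H_v` the stable norm fibre is ONE class —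
# a `G`-regular `γ_H′` matching the same `γ` as a `G`-regular `γ_H ∈ M_H` is stably conjugate to `γ_H` (Rogawski 1990 §5.4 p. 78; §3.6; §4.3 (4.3.1))

Cell `pub/hodgecm-mathlib`, crux H413 = `stmt-HodgeConjecture-24833` (lane `--supports … --as helper`, count-neutral); seat F0P2-p01 (g25) ((A1″) pen; the `hone` letter of
★-cand (U2) `F0P3cStCharTSUpTrSplitSlot.splitTorus_upIntegrand_eq_of_inputs`, WANTS-U2 §(b)).  THEOREMS ONLY (no definition ∕ instance ∕ notation ∕ named fact ∕ `sorry`); ★-only imports.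

THE MATHEMATICS.  `v` non-split, `w` THE place above it (★ `PlacesOver.subsingleton_of_smul_eq`), `σ_w` the local conjugation.  For `γ_H = (t, u_s) ∈ M_H` with `t = diag(d, e) ∈ M₂`
(★ `coe_eq_diag_of_mem_torusU`; `σ d · e = 1 = σ e · d`, ★ `map_entry_mul_entry_eq_one_of_mem_torusU`), `charpoly ι_v(γ_H) = (X − d)(X − e)(X − u_s)`.  If `γ_H′` is `G`-regular and matches
the same `γ`, its `U(Φ₁)`-slot `u = finGammaTwo γ_H′` is a root of `charpoly γ = χ_t · (X − u_s)` (★ `IsLocalNormPair.charpoly_eq` ∕ `.isRoot_finGammaTwo`), i.e. `(u − d)(u − e)(u − u_s) = 0`,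
and `σ u · u = 1` (★ `conjLocal_finGammaTwo_mul_finGammaTwo`).  Read at `w` (a field): `u_w = d_w` would give `σ_w(d_w) d_w = 1 = σ_w(d_w) e_w`, so `d_w = e_w` — against the
`G`-regularity of `γ_H` (`d − e` is a unit, ★ `isUnit_sub_of_separable` on the separable `χ_t`, ★ `IsLocalGRegular.separable_finCharpolyTwo`); likewise `u_w ≠ e_w`.  Hence `u = u_s`
and ★ (F2) `isLocalStablyConjH_of_isLocalNormPair_of_finGammaTwo_eq` concludes.  (For the COMPACT Cartan subgroups the fibre has 1 or 3 classes — ★ (E2b)∕(E2); the split member is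
the `c = 1` case of CENSUS-A1pp §3 (U2), «norm-one eigenvalue unique».)
* `isLocalStablyConjH_of_isLocalNormPair_of_mem_splitTorusH` — the statement above; `hone_splitTorusH` — the (U2) letter `hone` verbatim at `MH := M₂.prod ⊤`.
HONEST LABEL: count-neutral helper toward (A1″); closes no organ; HC_CM is proved only modulo the printed citations (hLiu418 24832 ∕ h413 24833) until rung 0 closes.

## References
* [Rogawski1990] J. D. Rogawski, *Automorphic Representations of Unitary Groups in Three Variables*, Ann. of Math. Stud. 123 (1990): §5.4 p. 78 (the stable classes of `H` over
  a class of `G` are told apart by the `U(1)`-slot), §3.6 pp. 28–31 (the split torus), §4.3 (4.3.1)–(4.3.2) pp. 42–43 (`γ_H → γ`), §1.10 p. 9 (`M = {d(α, β, ᾱ⁻¹)}`).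
* [LanglandsShelstad1987] R. P. Langlands, D. Shelstad, *On the definition of transfer factors*, Math. Ann. 278 (1987), §1.3.
-/

set_option autoImplicit false
-- the mandated namespace has the single-problem summit's repeated segment (`HodgeConjecture.HodgeConjecture`)
set_option linter.dupNamespace false

noncomputable section

open NumberField IsDedekindDomain Matrix Polynomial
open scoped MatrixGroups
open Literature.NumberTheory.GaloisRepresentations
open Literature.NumberTheory.Automorphic Literature.NumberTheory.Automorphic.UnitaryGroup
open Literature.NumberTheory.Rogawski1990
open Summit.HodgeConjecture.HodgeConjecture.Cruxes.H413.F0P3cStCharTSUpTrU2Chart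

namespace Summit.HodgeConjecture.HodgeConjecture.Cruxes.H413.F0P3cStCharTSUpTrSplitFibreOne

variable (L : Type) [Field L] [NumberField L] [IsCMField L] (v : HeightOneSpectrum (𝓞 ↥(maximalRealSubfield L)))

/-- **OVER THE SPLIT CARTAN `M_H = M₂ × U(Φ₁)` THE STABLE NORM FIBRE IS ONE CLASS.**  `v` non-split; `γ_H ∈ M₂.prod ⊤` and `γ_H′` both `G`-regular, both matching the same
`γ ∈ U(Φ₃)(L⁺_v)`: then `γ_H′ ∼_st γ_H` — the `U(Φ₁)`-slot of `γ_H′` is a NORM-ONE root of `charpoly γ = (X − d)(X − e)(X − u_s)`, and the two roots `d, e` of `χ_{γ_H.1}` (`σ d · e = 1`)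
cannot be norm-one without `d = e`, which `G`-regularity forbids. [cite: Rogawski1990, §5.4 p. 78; §3.6 pp. 28–31; §4.3 (4.3.1) p. 43] [cite: LanglandsShelstad1987, §1.3] -/
theorem isLocalStablyConjH_of_isLocalNormPair_of_mem_splitTorusH (hns : ∀ w : PlacesOver L v, IsCMField.complexConj L • w.1 = w.1)
    {s a : ((UnitaryGroup.cmDatum L 2 (Matrix.of fun i j : Fin 2 => if i.val + j.val + 1 = 2 then (1 : L) else 0)).Local v × (UnitaryGroup.cmDatum L 1 (Matrix.of fun i j : Fin 1 => if i.val + j.val + 1 = 1 then (1 : L) else 0)).Local v)} {γ : Gqs L v}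
    (hsM : s ∈ (Subgroup.prod (G := (UnitaryGroup.cmDatum L 2 (Matrix.of fun i j : Fin 2 => if i.val + j.val + 1 = 2 then (1 : L) else 0)).Local v)
      (N := (UnitaryGroup.cmDatum L 1 (Matrix.of fun i j : Fin 1 => if i.val + j.val + 1 = 1 then (1 : L) else 0)).Local v) (cmBorelTriple L 2 v).M ⊤))
    (hs : IsLocalGRegular L v s) (ha : IsLocalGRegular L v a)
    (hsγ : IsLocalNormPair L (qsForm L) v s γ) (haγ : IsLocalNormPair L (qsForm L) v a γ) :
    IsLocalStablyConjH L v a s := by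
  -- the single place `w ∣ v` and reading elements of `Π_{w'} L_{w'}` at `w`
  obtain ⟨w⟩ := (inferInstance : Nonempty (PlacesOver L v))
  have hw := hns w
  haveI hvss : Subsingleton (PlacesOver L v) := PlacesOver.subsingleton_of_smul_eq (IsCMField.complexConj L) (IsCMField.complexConj_ne_one L) w hw
  have happ : ∀ {y z : UnitaryGroup.LocalRing L v}, y w = z w → y = z := fun {y z} h => funext fun w' => by
    obtain rfl : w' = w := Subsingleton.elim _ _
    exact h
  -- the split torus entries `d, e` of `s.1 = diag(d, e)`, `σ d · e = 1 = σ e · d`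
  have hs1 : s.1 ∈ (cmBorelTriple L 2 v).M := (Subgroup.mem_prod.1 hsM).1
  obtain ⟨d, hd⟩ : ∃ d : UnitaryGroup.LocalRing L v, d = (s.1.val : GL (Fin 2) (UnitaryGroup.LocalRing L v)).val 0 0 := ⟨_, rfl⟩
  obtain ⟨e, he⟩ : ∃ e : UnitaryGroup.LocalRing L v, e = (s.1.val : GL (Fin 2) (UnitaryGroup.LocalRing L v)).val 1 1 := ⟨_, rfl⟩
  have h12 := map_entry_mul_entry_eq_one_of_mem_torusU (conjLocal L (IsCMField.complexConj L) v) (cmLocalForm_eq_over L 2 v) hs1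
  have h₁ : conjLocal L (IsCMField.complexConj L) v d * e = 1 := by rw [hd, he]; exact h12.1
  have h₂ : conjLocal L (IsCMField.complexConj L) v e * d = 1 := by rw [hd, he]; exact h12.2
  have hdiag : (s.1.val : GL (Fin 2) (UnitaryGroup.LocalRing L v)).val = !![d, 0; 0, e] := by
    rw [hd, he]; exact coe_eq_diag_of_mem_torusU (conjLocal L (IsCMField.complexConj L) v) hs1
  -- `χ_{s.1} = (X − d)(X − e)`
  have hcp : finCharpolyTwo L v s = (X - C d) * (X - C e) := by
    show ((s.1.val : GL (Fin 2) (UnitaryGroup.LocalRing L v)).val).charpoly = _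
    rw [hdiag, Matrix.charpoly_fin_two, Matrix.trace_fin_two_of, Matrix.det_fin_two_of, map_add, mul_zero, sub_zero, map_mul]
    ring
  -- `d − e` is a unit (`G`-regularity of `s`), so `d_w ≠ e_w`
  have hde : IsUnit (d - e) := by
    have hsep := hs.separable_finCharpolyTwo L v
    rw [hcp] at hsep
    exact F0P3cStCharTSEllInnerSlotMaps.isUnit_sub_of_separable L v hsep
  have hdew : d w ≠ e w := fun h => by
    have hu : IsUnit ((d - e) w) := hde.map (Pi.evalRingHom (fun w' : PlacesOver L v => w'.1.adicCompletion L) w)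
    rw [Pi.sub_apply, h, sub_self] at hu
    exact not_isUnit_zero hu
  -- the slot `u` of `a` is a root of `charpoly γ = χ_{s.1} · (X − u_s)`
  obtain ⟨u, hudef⟩ : ∃ u : UnitaryGroup.LocalRing L v, u = finGammaTwo L v a := ⟨_, rfl⟩
  obtain ⟨us, husdef⟩ : ∃ us : UnitaryGroup.LocalRing L v, us = finGammaTwo L v s := ⟨_, rfl⟩
  have hroot : (u - d) * (u - e) * (u - us) = 0 := by
    have h := haγ.isRoot_finGammaTwo L (qsForm L) v
    rw [hsγ.charpoly_eq L (qsForm L) v, hcp, IsRoot, eval_mul, eval_mul, eval_sub, eval_sub, eval_sub, eval_X, eval_C, eval_C, eval_C, ← hudef, ← husdef] at h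
    exact h
  -- norm one: `σ u · u = 1`
  have hu1 : conjLocal L (IsCMField.complexConj L) v u * u = 1 := by rw [hudef]; exact conjLocal_finGammaTwo_mul_finGammaTwo L v a
  -- read everything at `w`
  have h₁w : galAdicCompletionMap (L := L) (IsCMField.complexConj L) hw (d w) * e w = 1 := by
    have := congrArg (fun y : UnitaryGroup.LocalRing L v => y w) h₁
    simpa only [Pi.mul_apply, Pi.one_apply, conjLocal_apply_eq_galAdicCompletionMap L v w hw] using this
  have h₂w : galAdicCompletionMap (L := L) (IsCMField.complexConj L) hw (e w) * d w = 1 := by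
    have := congrArg (fun y : UnitaryGroup.LocalRing L v => y w) h₂
    simpa only [Pi.mul_apply, Pi.one_apply, conjLocal_apply_eq_galAdicCompletionMap L v w hw] using this
  have hu1w : galAdicCompletionMap (L := L) (IsCMField.complexConj L) hw (u w) * u w = 1 := by
    have := congrArg (fun y : UnitaryGroup.LocalRing L v => y w) hu1
    simpa only [Pi.mul_apply, Pi.one_apply, conjLocal_apply_eq_galAdicCompletionMap L v w hw] using this
  have hrootw : (u w - d w) * (u w - e w) * (u w - us w) = 0 := by
    have := congrArg (fun y : UnitaryGroup.LocalRing L v => y w) hroot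
    simpa only [Pi.mul_apply, Pi.sub_apply, Pi.zero_apply] using this
  -- the three cases in the field `L_w`
  rcases mul_eq_zero.1 hrootw with h12 | h3
  · exfalso
    rcases mul_eq_zero.1 h12 with h1 | h2
    · -- `u_w = d_w`: `σ(d_w) d_w = 1 = σ(d_w) e_w`, so `d_w = e_w`
      have hud : u w = d w := sub_eq_zero.1 h1
      rw [hud] at hu1w
      exact hdew ((eq_inv_of_mul_eq_one_right hu1w).trans (eq_inv_of_mul_eq_one_right h₁w).symm)
    · -- `u_w = e_w`: `σ(e_w) e_w = 1 = σ(e_w) d_w`, so `e_w = d_w`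
      have hue : u w = e w := sub_eq_zero.1 h2
      rw [hue] at hu1w
      exact hdew ((eq_inv_of_mul_eq_one_right h₂w).trans (eq_inv_of_mul_eq_one_right hu1w).symm)
  · -- `u = u_s`: same slot, same target class ⇒ stably conjugate (★ (F2))
    have hu : finGammaTwo L v a = finGammaTwo L v s := by rw [← hudef, ← husdef]; exact happ (sub_eq_zero.1 h3)
    exact isLocalStablyConjH_of_isLocalNormPair_of_finGammaTwo_eq L (qsForm L) v ha haγ hsγ hu

/-- **The (U2) letter `hone` AT `MH := M₂.prod ⊤`** (★-cand `F0P3cStCharTSUpTrSplitSlot.splitTorus_upIntegrand_eq_of_inputs`' binder, token for token).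
[cite: Rogawski1990, §5.4 p. 78; §3.6 pp. 28–31] -/
theorem hone_splitTorusH (hns : ∀ w : PlacesOver L v, IsCMField.complexConj L • w.1 = w.1) :
    ∀ s ∈ (Subgroup.prod (G := (UnitaryGroup.cmDatum L 2 (Matrix.of fun i j : Fin 2 => if i.val + j.val + 1 = 2 then (1 : L) else 0)).Local v)
      (N := (UnitaryGroup.cmDatum L 1 (Matrix.of fun i j : Fin 1 => if i.val + j.val + 1 = 1 then (1 : L) else 0)).Local v) (cmBorelTriple L 2 v).M ⊤),
      IsLocalGRegular L v s → ∀ a : ((UnitaryGroup.cmDatum L 2 (Matrix.of fun i j : Fin 2 => if i.val + j.val + 1 = 2 then (1 : L) else 0)).Local v × (UnitaryGroup.cmDatum L 1 (Matrix.of fun i j : Fin 1 => if i.val + j.val + 1 = 1 then (1 : L) else 0)).Local v), IsLocalGRegular L v a → ∀ γ : Gqs L v,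
        IsLocalNormPair L (qsForm L) v s γ → IsLocalNormPair L (qsForm L) v a γ → IsLocalStablyConjH L v a s :=
  fun _ hsM hs _ ha _ hsγ haγ => isLocalStablyConjH_of_isLocalNormPair_of_mem_splitTorusH L v hns hsM hs ha hsγ haγ

end Summit.HodgeConjecture.HodgeConjecture.Cruxes.H413.F0P3cStCharTSUpTrSplitFibreOne

end
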